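import Summits.QuantumFields.YangMills.Theorems.AlphaInputsT3ACv3InnerLiftFromRegionalThm1
import Summits.QuantumFields.YangMills.Theorems.AlphaInputsT3ACv3ThetaWindow
import HarnessLib

/-!
# `AlphaInputsT3ACv3InnerLiftFromRegionalWindow` — (FL) KNIT, THE WINDOW STEP: **(FL) `InnerFineLiftsT3` from a regional lift theorem that carries the explicit smallness binder
# `ε_W(k) ≤ ε_FL`, discharged on the record's coupling window by (FL-θ)** — lane `pub-balaban3d` ∕ cell `ym3-torus`, seat alpha-2 (g6); ★★OWNER g25 RULING (FL-SMALL) 03:29:46Z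
# («every (FL) knit carries the explicit binder `(hε : ε′ ≤ ε_FL)` … the final `hLift` knit (M22) discharges it by (FL-θ)»)

WHY.  ★w1-19936 g0's `AlphaInputsT3AC.innerFineLiftsT3_of_regionalLifts` (p590363) turns the regional lift binder `hLift` (for every `k + 1 ≤ K`, admissible non-trivial `h`, datum
`V` windowed by `ε_W(k) = 2L²·avgWindowFactor·θ(K−k)` on `plaqsIn k Ω_{k+1}(h)`: an exact `k`-fold lift on `bondsIn k Ω_{k+1}(h)` with finest plaquettes `< B·ε_W(k)·L^{−2k}`) into
`InnerFineLiftsT3 … (B·L²)`.  The regional Newton lift of record (★w4 (H) `exists_exact_lift_regional_window_kfree` ∘ START v3) delivers that binder only UNDER A SMALLNESS ROW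
`ε_W(k) ≤ ε_FL` with `ε_FL` a closed numeral.  THIS FILE is the adapter: ★★ `innerFineLiftsT3_of_regionalLifts_window` takes the windowed binder `hLiftW` (the same, with the extra
premise `ε_W(k) ≤ ε_FL`) and the ONE arithmetic record row `avgWindowFactor L ≤ 8·B₃·Z_full·ε_FL`, and returns `InnerFineLiftsT3 … (B·L²)` — the window premise is discharged
for EVERY `k` by `ThetaWindow.window_le_of_window` (`ε_W ≤ avgWindowFactor/(8·B₃·Z_full)` on `γ ≤ (min γ₀ 1)²`) and the non-negativity of the windows by `θBal_pos`.
WHAT (def-free).  `window_le_epsFL` (the row ⇒ `ε_W(i) ≤ ε_FL` for every `i`), ★★ `AlphaInputsT3AC.innerFineLiftsT3_of_regionalLifts_window`.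
HONEST FRAMING.  Composition of landed theorems; the windowed regional lift binder is a HYPOTHESIS (the (FL) team's end theorem), never asserted; count-neutral helper toward the
(FL) row of R3 2′∕2′χ (`stub_laneRecordsV3`, items 19935∕19936 — NOT proved here); registry untouched; nothing about d = 4, the continuum, or a mass gap; YM₃ on T³ is rung R3,
not the Clay problem.

References: T. Bałaban, Commun. Math. Phys. 102 (1985) 277–309 [Balaban1985Variational] (Thm 1 (8) p.279, (11)–(14) pp.279–280); CMP 102 (1985) 255–275 [Balaban1985UV3]
((7) p.257, (40)+(42) p.266, (45) p.267).
-/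

set_option autoImplicit false

noncomputable section

namespace Summit.QuantumFields.YangMills.Theorems

open Set
open scoped Matrix.Norms.L2Operator
open Literature.MathematicalPhysics.QuantumFieldTheory.Balaban1983to89
open Literature.MathematicalPhysics.QuantumFieldTheory.Balaban1983to89.T3ContinuumYM3Torus
open Literature.MathematicalPhysics.QuantumFieldTheory.Balaban1983to89.T3UnitLawDensityEML (ℰp)
open Literature.MathematicalPhysics.QuantumFieldTheory.Balaban1983to89.T3UnitScaleTilt (θBal)
open Literature.MathematicalPhysics.QuantumFieldTheory.Balaban1983to89.T3MinimiserStabilityReduction (θBal_pos)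
open Literature.MathematicalPhysics.QuantumFieldTheory.Balaban1983to89.B10Eq38TorusDomains (plaqsIn)
open Literature.MathematicalPhysics.QuantumFieldTheory.Balaban1983to89.B10Eq42TorusConstraint (bondsIn)
open Literature.MathematicalPhysics.QuantumFieldTheory.Balaban1985CMP102.Setting
open Summit.QuantumFields.Balaban3D.Carriers
open Summit.QuantumFields.Balaban3D.Proofs.Primitives (AlphaConsts)
open Summit.QuantumFields.YangMills.Theorems.ThetaWindow (window_le_of_window)

section T3

variable {F : T3Family} {𝔠 : AlphaConsts F.L (suGroupModel 2).N} {γ : ℝ} {hγ : 0 < γ} {hγ1 : γ ≤ (min 𝔠.gamma0 1) ^ 2} {K : ℕ}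

/-- **THE RECORD ROW GIVES THE WINDOW BOUND AT EVERY LEVEL**: if `avgWindowFactor L ≤ 8·B₃·Z_full·ε_FL` then `ε_W(i) = 2L²·avgWindowFactor L·θ(i) ≤ ε_FL` for every `i` on the
coupling window `0 < γ ≤ (min γ₀ 1)²`. [cite: Balaban1985UV3, (7) p.257, (45) p.267] -/
theorem window_le_epsFL (𝔠 : AlphaConsts F.L (suGroupModel 2).N) {γ : ℝ} (hγ : 0 < γ) (hγ1 : γ ≤ (min 𝔠.gamma0 1) ^ 2) {εFL : ℝ}
    (hrow : avgWindowFactor F.L ≤ 8 * 𝔠.B₃ * 𝔠.Zfull * εFL) (i : ℕ) :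
    2 * (F.L : ℝ) ^ 2 * avgWindowFactor F.L * θBal F.L γ 𝔠.b₀ 𝔠.p₀ i ≤ εFL := by
  have hB := 𝔠.B₃_pos; have hZ := 𝔠.Zfull_pos
  have hpos : 0 < 8 * 𝔠.B₃ * 𝔠.Zfull := by positivity
  refine (window_le_of_window 𝔠 hγ hγ1 i).trans ?_
  rw [div_le_iff₀ hpos]
  linarith

variable (F 𝔠 γ hγ hγ1 K) in
/-- **★★ (FL) FROM THE WINDOWED REGIONAL LIFT BINDER AND ONE RECORD ROW** (`1 ≤ B`).  `hLiftW`: for every `k + 1 ≤ K`, admissible non-trivial `h` at level `k + 1`, every level-`k`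
datum `V` with `dist1 (V ∂Q) ≤ ε_W(k)` on `plaqsIn k Ω_{k+1}(h)`, PROVIDED `ε_W(k) ≤ ε_FL`: an exact `k`-fold lift on `bondsIn k Ω_{k+1}(h)` with finest plaquettes `< B·ε_W(k)·L^{−2k}` under
`Ω_{k+1}(h)` — the (FL) team's end theorem with its smallness row displayed.  `hrow`: `avgWindowFactor L ≤ 8·B₃·Z_full·ε_FL` (chosen at the record's construction).  Conclusion:
`InnerFineLiftsT3 F 𝔠 γ hγ hγ1 K (B·L²)` (★w1 g0's `innerFineLiftsT3_of_regionalLifts` after discharging the window by `window_le_epsFL` and `0 ≤ θ` by `θBal_pos`).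
[cite: Balaban1985Variational, Thm 1 (8) p.279, (11)–(14) pp.279–280; Balaban1985UV3, (40)+(42) p.266, (45) p.267] -/
theorem AlphaInputsT3AC.innerFineLiftsT3_of_regionalLifts_window {B εFL : ℝ} (hB : 1 ≤ B)
    (hrow : avgWindowFactor F.L ≤ 8 * 𝔠.B₃ * 𝔠.Zfull * εFL)
    (hLiftW : ∀ (k : ℕ), k + 1 ≤ K → ∀ (h : Hist (F.P K) (k + 1)),
      Hist.Admissible 𝔠.lane.carrier.M₁ (rcolOf (T3Scales F γ hγ (hγ1.trans (sq_min_one_le _ 𝔠.gamma0_pos)) K) 𝔠.lane.carrier) (k + 1) h →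
      h ≠ Hist.triv (F.P K) (k + 1) → ∀ (V : GaugeField (F.P K) k (Matrix.specialUnitaryGroup (Fin 2) ℂ)),
        (∀ Q : Plaq (F.P K) k, Q ∈ plaqsIn k (Omega 𝔠.lane.carrier.M₁
            (rcolOf (T3Scales F γ hγ (hγ1.trans (sq_min_one_le _ 𝔠.gamma0_pos)) K) 𝔠.lane.carrier) (k + 1) h (k + 1)) →
          GaugeGroup.dist1 (GaugeField.plaqHol V Q) ≤ 2 * (F.L : ℝ) ^ 2 * avgWindowFactor F.L * θBal F.L γ 𝔠.b₀ 𝔠.p₀ (K - k)) →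
        2 * (F.L : ℝ) ^ 2 * avgWindowFactor F.L * θBal F.L γ 𝔠.b₀ 𝔠.p₀ (K - k) ≤ εFL →
        ∃ U : GaugeField (F.P K) 0 (Matrix.specialUnitaryGroup (Fin 2) ℂ),
          (∀ b : PBond (F.P K) k, b ∈ bondsIn k (Omega 𝔠.lane.carrier.M₁
              (rcolOf (T3Scales F γ hγ (hγ1.trans (sq_min_one_le _ 𝔠.gamma0_pos)) K) 𝔠.lane.carrier) (k + 1) h (k + 1)) →
            Averaging.iter (fun i => BlockAveraging.blockAvg (P := F.P K) (j := i) ℰp) k U b = V b) ∧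
          ∀ q : Plaq (F.P K) 0, q ∈ plaqsIn 0 (Omega 𝔠.lane.carrier.M₁
              (rcolOf (T3Scales F γ hγ (hγ1.trans (sq_min_one_le _ 𝔠.gamma0_pos)) K) 𝔠.lane.carrier) (k + 1) h (k + 1)) →
            GaugeGroup.dist1 (GaugeField.plaqHol U q) <
              B * (2 * (F.L : ℝ) ^ 2 * avgWindowFactor F.L * θBal F.L γ 𝔠.b₀ 𝔠.p₀ (K - k)) * (((F.L : ℝ) ^ k)⁻¹) ^ 2) :
    AlphaInputsT3AC.InnerFineLiftsT3 F 𝔠 γ hγ hγ1 K (B * (F.L : ℝ) ^ 2) := by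
  have hγone : γ ≤ 1 := by
    have h0 : 0 ≤ min 𝔠.gamma0 1 := le_min 𝔠.gamma0_pos.le zero_le_one
    exact hγ1.trans (by nlinarith [min_le_right 𝔠.gamma0 1, h0])
  refine AlphaInputsT3AC.innerFineLiftsT3_of_regionalLifts F 𝔠 γ hγ hγ1 K hB
    (fun k _ => (θBal_pos F.hL.2.le hγ hγone 𝔠.b₀_pos 𝔠.p₀ _).le) ?_
  intro k hk h hadm hnt V hV
  exact hLiftW k hk h hadm hnt V hV (window_le_epsFL 𝔠 hγ hγ1 hrow (K - k))

end T3

end Summit.QuantumFields.YangMills.Theorems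

end
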